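import Summits.ValiantsHypothesis.ValiantsHypothesis.Theorems.KPlusLogSqLawTropicalBToeplitzDoublingMorph
import Summits.ValiantsHypothesis.ValiantsHypothesis.Theorems.KPlusLogSqLawTropicalBToeplitzDoublingTower

/-!
# Route `KPlusLogSqLaw`, crux `TropicalB` — Toeplitz sector: `Φ_Q` IS SUPER-LINEAR — `¬ConjectureQ` and `¬ConjectureTLinear` (unconditional)

HONEST FRAMING.  Helper toward the registered stubs `stub_tropThin` / `stub_tropFat` (crux `…Theses.KPlusLogSqLaw.TropicalB`, item
`stmt-ValiantsHypothesis-19771`; cell `pub-symmetroid`, seat `val-sym-trop-p4` (g23), 2026-08-29).  Iterating THE MORPH-DOUBLING LAW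
(`fixedSlope_sq_doubling_morph`, `…ToeplitzDoublingMorph`: `Φ_Q(2n) ≥ 2Φ_Q(n) − 1 + ⌊n/4⌋`) on the kernel row `Φ_Q(32) ≥ 161`
(`…ToeplitzThirtyTwo161` via `not_fixedSlopeInstanceBound_sq_tower32 0`): `Φ_Q(32·2^k) ≥ 2^k·(160 + 4k) + 1` for every `k`
(`not_fixedSlopeInstanceBound_sq_tower32_superlinear`), hence the count of unique optima of the ONE-direction quadratic-slope class is NOT
`O(m)` (`not_fixedSlopeInstanceBound_sq_linear`: explicit failure size `32·2^(8C)` for every constant `C`), and the cell's linear CONJECTURE T / Q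
(`…ToeplitzConjectureT`) are FALSE: **`linear_toeplitz_conjectures_false : ¬ ConjectureQ ∧ ¬ ConjectureTLinear`** (one conjunction — the bare
conclusions exist conditionally under `hM` in `…ToeplitzDoublingTower` §Morph; here no hypothesis: the `⌊n/4⌋`-law replaces `hM`).  What survives: `ConjectureTPoly` (`Φ_Toep(m) ≤ (m+1)^C`), which is all
the Toeplitz-sector reduction `toeplitz_chain_le_of_linearBound` / `toeplitzSector_of_conjectureTPoly` needs, is consistent with every located
datum (exponent ≈ 1.85–1.9 on m ≤ 64, memo DOUBLING-g22.md §2) and is UNTOUCHED here.  Nothing here bears on `TropicalB` for general designs,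
`WeakLifting`, `MatrixDescartes` (18050) or `VP ≠ VNP`.
-/

set_option linter.dupNamespace false
set_option autoImplicit false

namespace Summit.ValiantsHypothesis.ValiantsHypothesis.Theorems.KPlusLogSqLaw.Toeplitz

/-- **Super-linear tower**: `Φ_Q(32·2^k) ≥ 2^k·(160 + 4k) + 1` for every `k` — unconditional (the morph-doubling law iterated on the
kernel row `Φ_Q(32) ≥ 161`). -/
theorem not_fixedSlopeInstanceBound_sq_tower32_superlinear (k : ℕ) :
    ¬ FixedSlopeInstanceBound (32 * 2 ^ k) (fun δ : ℤ => δ ^ 2) (2 ^ k * (160 + 4 * k)) := by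
  induction k with
  | zero => simpa using not_fixedSlopeInstanceBound_sq_tower32 0
  | succ k ih =>
    have hq : 2 ≤ 16 * 2 ^ k := by have := Nat.one_le_two_pow (n := k); omega
    have e0 : 32 * 2 ^ k = 2 * (16 * 2 ^ k) := by ring
    rw [e0] at ih
    have h := fixedSlope_sq_doubling_morph hq ih ih
    have e1 : 32 * 2 ^ (k + 1) = 2 * (16 * 2 ^ k) + 2 * (16 * 2 ^ k) := by ring
    have e3 : 16 * 2 ^ k / 2 = 8 * 2 ^ k := by omega
    have e2 : 2 ^ (k + 1) * (160 + 4 * (k + 1)) = 2 ^ k * (160 + 4 * k) + 2 ^ k * (160 + 4 * k) + 16 * 2 ^ k / 2 := by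
      rw [e3]; ring
    rw [e1, e2]
    exact h

/-- **All-size floor along the tower**: `LinearInstanceBound (32·2^k) Φ → 2^k(160+4k) + 1 ≤ Φ`. -/
theorem le_of_linearInstanceBound_tower32_superlinear (k : ℕ) {Φ : ℕ} (h : LinearInstanceBound (32 * 2 ^ k) Φ) :
    2 ^ k * (160 + 4 * k) + 1 ≤ Φ := by
  rcases Nat.lt_or_ge Φ (2 ^ k * (160 + 4 * k) + 1) with hlt | hge
  · exact absurd ((linearInstanceBound_iff_fixedSlope _ _).mp (h.mono (by omega)) (fun δ : ℤ => δ ^ 2))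
      (not_fixedSlopeInstanceBound_sq_tower32_superlinear k)
  · exact hge

/-- **Explicit failure size for every linear constant**: at `m = 32·2^(8C)` the quadratic-slope class has a kernel chain longer than `C·m`. -/
theorem not_fixedSlopeInstanceBound_sq_linear (C : ℕ) :
    ¬ FixedSlopeInstanceBound (32 * 2 ^ (8 * C)) (fun δ : ℤ => δ ^ 2) (C * (32 * 2 ^ (8 * C))) := by
  intro h
  have hle : C * (32 * 2 ^ (8 * C)) ≤ 2 ^ (8 * C) * (160 + 4 * (8 * C)) := by
    have e : C * (32 * 2 ^ (8 * C)) = 2 ^ (8 * C) * (32 * C) := by ring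
    rw [e]
    exact Nat.mul_le_mul_left _ (by omega)
  exact not_fixedSlopeInstanceBound_sq_tower32_superlinear (8 * C) (h.mono hle)

/-- **THE CELL'S LINEAR TOEPLITZ CONJECTURES ARE FALSE (unconditional): `¬ ConjectureQ ∧ ¬ ConjectureTLinear`** — the number of unique optima of
the quadratic-slope class is not `O(m)`, hence neither is `Φ_Toep(m)` (`T ⇒ Q`, `conjectureQ_of_TLinear`).  Stated as ONE conjunction because the
tree already carries the bare conclusions CONDITIONALLY (`not_conjectureQ_of_morph` / `not_conjectureTLinear_of_morph`, `…ToeplitzDoublingTower`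
§Morph, under the unproved hypothesis `hM`); this theorem has no hypothesis — use `.1` / `.2`. -/
theorem linear_toeplitz_conjectures_false : ¬ ConjectureQ ∧ ¬ ConjectureTLinear := by
  have hQ : ¬ ConjectureQ := by
    rintro ⟨C, hC⟩
    exact not_fixedSlopeInstanceBound_sq_linear C (hC (32 * 2 ^ (8 * C)))
  exact ⟨hQ, fun h => hQ (conjectureQ_of_TLinear h)⟩

/-- the super-linear floor in closed form along the tower: `Φ_Toep(m) ≥ (m/32)·(160 + 4·log₂(m/32)) + 1 = 5m + (m/8)·log₂(m/32) + 1`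
at `m = 32·2^k`, stated as the failure of every bound below it. -/
theorem not_linearInstanceBound_tower_superlinear (k : ℕ) :
    ¬ LinearInstanceBound (32 * 2 ^ k) (2 ^ k * (160 + 4 * k)) := fun h =>
  absurd (le_of_linearInstanceBound_tower32_superlinear k h) (by omega)

end Summit.ValiantsHypothesis.ValiantsHypothesis.Theorems.KPlusLogSqLaw.Toeplitz
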